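import Literature.AnabelianGeometry.EtaleTheta.Thm56SubdagStatements
import Literature.AnabelianGeometry.EtaleTheta.ThetaFrobenioidOfModel
import Literature.AnabelianGeometry.EtaleTheta.ThetaSubquotientOfTempered

/-!
# [EtTh] Prop. 5.5 — the functoriality laws of the two transports, at the canonical instances (PDF pp. 101–102)

Mochizuki, *The étale theta function …*, Publ. RIMS **45** (2009)
[cite: MochizukiEtTh2009, Prop 5.5 proof p.328 (PDF p.102)].  abc-iut cell, layer L2, §K row K4 (seat
abc-iut-w5-d020 gen 2); PROOF-ONLY (no definitions).  Sub-nodes **P55-L06b** («composites of linear morphisms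
transport compositionally») and **T56-L09d** (`φ ≫ u = u_S ≫ φ`) of plan/L2/SUBDAG-EtTh-Thm56.md: the typed laws
`Thm56Sub.UnitsPullComp/UnitsPullId/UnitsPullSpec` (on the stub field `TemperedFrobenioidStub.unitsPull`) and
`Thm56Sub.LDeltaMapComp/LDeltaMapId` (on `ThetaSubquotientStub.lDeltaMap`) of `Thm56SubdagStatements.lean`
(p417674) are LAWS OF THE ABSTRACT §5 DATUM; this file proves their MATHEMATICAL CONTENT at the two canonical
instances the W3-L2-01 constructor (`ThetaFrobenioid.ofSetting`, abc-iut-L2-t4/t9) assembles: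
* for abc-iut-L1/L2-t9's model Frobenioid — `ModelFrobenioid.unitsPull_comp`, `ModelFrobenioid.unitsPull_id`:
  the pull-back of units `O^×(Y) → O^×(X)` of `ModelFrobenioid.unitsPull` ([FrdI] Thm. 5.2 (ii):
  `(Div u, u) ↦ (Φ(Base φ) Div u, B(Base φ) u)`) is contravariantly functorial; the intertwining square for
  LINEAR `φ` is abc-iut-L2-t9's landed `ModelFrobenioid.comp_eq_unitsPull_comp` / `ofModel_unitsPull_comp`
  (re-exported here in the `UnitsPullSpec` orientation as `TemperedFrobenioidStub.ofModel_unitsPullSpec`);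
* for abc-iut-L2-t9's theta subquotients over `B^temp(Π)` — `ThetaSubquotient.fam_apply_congr_of_hom`,
  `ThetaSubquotient.map_comp`, `ThetaSubquotient.map_id`: the push-forward `(l·Δ_Θ)_E → (l·Δ_Θ)_{E′}`
  (`ThetaSubquotient.map`, classes of compatible families evaluated at chosen preimages) is covariantly
  functorial — two preimages of a point under a composite lie in one `Π`-orbit and the family condition makes the
  choice invisible modulo `J(Stab)` (the template of abc-iut-L2-t9's `famPush_apply_congr`); hence the laws for the
  instance `thetaSubquotientStub q ι` (`thetaSubquotientStub_lDeltaMap_comp/_id`).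
At `ThetaFrobenioid.ofSetting` each of the five typed laws is then a one-line application of these.
HONEST FRAMING: kernel-checked statements about the cell's model objects; nothing of [EtTh] is asserted
unconditionally; typed ≠ discharged; no side taken on [IUTchIII] Cor. 3.12.
-/

noncomputable section

/-! ### The model Frobenioid: `unitsPull` is functorial -/

namespace Literature.AlgebraicGeometry.Frobenioids

namespace ModelFrobenioid

open CategoryTheory Opposite

universe w v u

variable {D : Type u} [Category.{v} D] {Φ B : Dᵒᵖ ⥤ CommMonCat.{w}} {DivB : B ⟶ monoidGp Φ}

/-- `Φ(f ≫ g)` applied: `Φ((f ≫ g)^op) x = Φ(f^op) (Φ(g^op) x)` (contravariance).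
[cite: MochizukiFrdI2008, Thm. 5.2(i) p.100] -/
theorem map_comp_apply_Φ {A A' A'' : D} (f : A ⟶ A') (g : A' ⟶ A'') (x : Φ.obj (op A'')) :
    (Φ.map (f ≫ g).op).hom x = (Φ.map f.op).hom ((Φ.map g.op).hom x) := by
  rw [op_comp, Φ.map_comp, CommMonCat.hom_comp, MonoidHom.comp_apply]

/-- `B(f ≫ g)` applied: `B((f ≫ g)^op) u = B(f^op) (B(g^op) u)`.
[cite: MochizukiFrdI2008, Thm. 5.2(i) p.100] -/
theorem map_comp_apply_B {A A' A'' : D} (f : A ⟶ A') (g : A' ⟶ A'') (u : B.obj (op A'')) :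
    (B.map (f ≫ g).op).hom u = (B.map f.op).hom ((B.map g.op).hom u) := by
  rw [op_comp, B.map_comp, CommMonCat.hom_comp, MonoidHom.comp_apply]

/-- **`O^×(−)` is contravariantly functorial on the model Frobenioid**: `(φ ≫ ψ)^* = φ^* ∘ ψ^*` on units
(components `Φ(Base(φ ≫ ψ)) = Φ(Base φ) ∘ Φ(Base ψ)`, likewise for `B`; [FrdI] Thm. 5.2 (ii), used in
[EtTh] Prop. 5.5 p.328 for the transport along composites of linear morphisms — sub-node P55-L06b).
[cite: MochizukiEtTh2009, Prop 5.5 proof p.328 (PDF p.102)] -/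
theorem unitsPull_comp {X Y Z : ModelFrobenioid Φ B DivB} (φ : X ⟶ Y) (ψ : Y ⟶ Z) :
    unitsPull (φ ≫ ψ) = (unitsPull φ).comp (unitsPull ψ) := by
  ext τ : 1
  apply Subtype.ext
  apply Aut.ext
  apply hom_ext
  · rw [(unitsPull (φ ≫ ψ) τ).2.2]
    exact ((unitsPull φ (unitsPull ψ τ)).2.2).symm
  · rw [(unitsPull (φ ≫ ψ) τ).2.1]
    exact ((unitsPull φ (unitsPull ψ τ)).2.1).symm
  · change (Φ.map (baseMap (φ ≫ ψ)).op).hom (div τ.1.hom) =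
      (Φ.map (baseMap φ).op).hom ((Φ.map (baseMap ψ).op).hom (div τ.1.hom))
    rw [baseMap_comp, map_comp_apply_Φ]
  · change (B.map (baseMap (φ ≫ ψ)).op).hom (unit τ.1.hom) =
      (B.map (baseMap φ).op).hom ((B.map (baseMap ψ).op).hom (unit τ.1.hom))
    rw [baseMap_comp, map_comp_apply_B]

/-- **`(𝟙)^* = id` on units of the model Frobenioid** (sub-node P55-L06b).
[cite: MochizukiEtTh2009, Prop 5.5 proof p.328 (PDF p.102)] -/
theorem unitsPull_id (X : ModelFrobenioid Φ B DivB) : unitsPull (𝟙 X) = MonoidHom.id (units X) := by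
  ext τ : 1
  apply Subtype.ext
  apply Aut.ext
  apply hom_ext
  · rw [(unitsPull (𝟙 X) τ).2.2]
    exact (τ.2.2).symm
  · rw [(unitsPull (𝟙 X) τ).2.1]
    exact (τ.2.1).symm
  · change (Φ.map (baseMap (𝟙 X)).op).hom (div τ.1.hom) = div τ.1.hom
    rw [baseMap_id, map_id_apply_Φ]
  · change (B.map (baseMap (𝟙 X)).op).hom (unit τ.1.hom) = unit τ.1.hom
    rw [baseMap_id, map_id_apply_B]

end ModelFrobenioid

end Literature.AlgebraicGeometry.Frobenioids

/-! ### abc-iut-L2-t9's `TemperedFrobenioidStub.ofModel`: the three `unitsPull` laws -/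

namespace Literature.AnabelianGeometry.EtaleTheta

namespace FrobenioidTheta

open CategoryTheory Opposite Literature.AlgebraicGeometry.Frobenioids

universe w v u

variable {D : Type u} [Category.{v} D] (Φ B : Dᵒᵖ ⥤ CommMonCat.{w}) (DivB : B ⟶ monoidGp Φ)
  (hΦ : ∀ A : Dᵒᵖ, IsIntegral (Φ.obj A)) (IsBFT : MorphismProperty (ModelFrobenioid Φ B DivB))

/-- At abc-iut-L2-t9's instance `TemperedFrobenioidStub.ofModel`, the stub's `unitsPull` IS `ModelFrobenioid.unitsPull`
(definitional), hence COMPOSITIONAL — the content of `Thm56Sub.UnitsPullComp` for every `ThetaFrobenioid` assembled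
over it (W3-L2-01).  [cite: MochizukiEtTh2009, Prop 5.5 proof p.328 (PDF p.102)] -/
theorem TemperedFrobenioidStub.ofModel_unitsPull_comp_comp {S T U : ModelFrobenioid Φ B DivB} (φ : S ⟶ T)
    (ψ : T ⟶ U) :
    (TemperedFrobenioidStub.ofModel Φ B DivB hΦ IsBFT).unitsPull (φ ≫ ψ) =
      ((TemperedFrobenioidStub.ofModel Φ B DivB hΦ IsBFT).unitsPull φ).comp
        ((TemperedFrobenioidStub.ofModel Φ B DivB hΦ IsBFT).unitsPull ψ) :=
  ModelFrobenioid.unitsPull_comp φ ψ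

/-- At `TemperedFrobenioidStub.ofModel`, `unitsPull (𝟙 S) = id` — the content of `Thm56Sub.UnitsPullId`.
[cite: MochizukiEtTh2009, Prop 5.5 proof p.328 (PDF p.102)] -/
theorem TemperedFrobenioidStub.ofModel_unitsPull_id (S : ModelFrobenioid Φ B DivB) :
    (TemperedFrobenioidStub.ofModel Φ B DivB hΦ IsBFT).unitsPull (𝟙 S) = MonoidHom.id _ :=
  ModelFrobenioid.unitsPull_id S

/-- At `TemperedFrobenioidStub.ofModel`, for a LINEAR `φ` the pulled-back unit makes the square `φ ≫ u = u_S ≫ φ`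
commute (abc-iut-L2-t9's landed `ofModel_unitsPull_comp`, re-oriented) — the content of `Thm56Sub.UnitsPullSpec`
(sub-node T56-L09d).  [cite: MochizukiEtTh2009, §4 p.312 (PDF p.86)] -/
theorem TemperedFrobenioidStub.ofModel_unitsPullSpec {S T : ModelFrobenioid Φ B DivB} (φ : S ⟶ T)
    (hφ : (TemperedFrobenioidStub.ofModel Φ B DivB hΦ IsBFT).pre.IsLinear φ)
    (τ : (TemperedFrobenioidStub.ofModel Φ B DivB hΦ IsBFT).pre.unitsSubgroup T) :
    φ ≫ (τ : Aut T).hom =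
      (((TemperedFrobenioidStub.ofModel Φ B DivB hΦ IsBFT).unitsPull φ τ :
        (TemperedFrobenioidStub.ofModel Φ B DivB hΦ IsBFT).pre.unitsSubgroup S) : Aut S).hom ≫ φ :=
  (ofModel_unitsPull_comp hΦ IsBFT φ hφ τ).symm

end FrobenioidTheta

/-! ### abc-iut-L2-t9's theta subquotients: the push-forward `map` is functorial -/

namespace ThetaSubquotient

open CategoryTheory Literature.AlgebraicGeometry.Frobenioids Literature.AnabelianGeometry.SemiGraphs
open Literature.AlgebraicGeometry.Frobenioids.QuasiTemperoid (stabilizerSubgroup)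
open Literature.AlgebraicGeometry.Frobenioids.QuasiTemperoid.BTempConnected (hom_ρ ρ_mul_apply
  exists_ρ_eq_of_isConnectedObj)

universe u v w

variable {G : Type u} [Group G] [TopologicalSpace G] {Q : Type v} [Group Q] {Λ : Type w}
  [CommGroup Λ] (q : G →* Q) (ι : Λ →* Q) [ι.range.Normal]

/-- **Two points of a connected `E` with the same image under a `Π`-map `h : E → E″` give the same class**:
for a compatible family `t`, `ι(t_{x′})⁻¹ · ι(t_x) ∈ J(Stab(h x))` — they lie in one `Π`-orbit, `x′ = k·x` with
`k ∈ Stab(h x)`, and the family condition at `(k, x)` together with the triviality of `q(k)`-conjugation modulo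
`J(Stab(h x))` does it (the template of abc-iut-L2-t9's `famPush_apply_congr`, which is the case `x′ = pre (h x)`).
[cite: MochizukiEtTh2009, §5 p.327 (PDF p.101)] -/
theorem fam_apply_congr_of_hom {E E'' : BTemp G} (hE : IsConnectedObj E) (h : E ⟶ E'') (t : Fam q ι E)
    {x x' : E.obj.V} (hx : (h.hom.hom x' : E''.obj.V) = h.hom.hom x) :
    (ι ((t : E.obj.V → Λ) x'))⁻¹ * ι ((t : E.obj.V → Λ) x) ∈
      killQ q ι (stabilizerSubgroup E'' (h.hom.hom x)) := by
  obtain ⟨k, hk⟩ := exists_ρ_eq_of_isConnectedObj E hE x x'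
  have hk' : E''.obj.ρ k (h.hom.hom x) = h.hom.hom x := by
    have e := congrArg (fun z => (h.hom.hom z : E''.obj.V)) hk
    simp only [hom_ρ] at e
    rw [e, hx]
  have hkS : k ∈ stabilizerSubgroup E'' (h.hom.hom x) := hk'
  have e : (h.hom.hom (E.obj.ρ k x) : E''.obj.V) = h.hom.hom x := by rw [hom_ρ, hk']
  have hle : stabilizerSubgroup E (E.obj.ρ k x) ≤ stabilizerSubgroup E'' (h.hom.hom x) := by
    intro s hs
    have h' := stabilizerSubgroup_le_of_hom h _ hs
    rwa [e] at h'
  have u := killQ_mono q ι hle (t.2 k x)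
  rw [hk] at u
  have hc : (ι ((t : E.obj.V → Λ) x))⁻¹ ∈ ι.range := ι.range.inv_mem (mem_range_self ι _)
  have v := conj_mul_inv_mem_killQ q ι (S := stabilizerSubgroup E'' (h.hom.hom x)) hc hkS
  have key : (ι ((t : E.obj.V → Λ) x'))⁻¹ * ι ((t : E.obj.V → Λ) x) =
      (ι ((t : E.obj.V → Λ) x'))⁻¹ * (q k * ι ((t : E.obj.V → Λ) x) * (q k)⁻¹) *
        (q k * (ι ((t : E.obj.V → Λ) x))⁻¹ * (q k)⁻¹ * (ι ((t : E.obj.V → Λ) x))⁻¹⁻¹) := by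
    group
  rw [key]
  exact (killQ q ι _).mul_mem u v

/-- **The transport `(l·Δ_Θ)_{(−)}` is compositional**: `map (f ≫ g) = map g ∘ map f` for `Π`-maps of connected
objects `E → E′ → E″` (the preimage chosen for `f ≫ g` and the iterated preimages have the same image;
`fam_apply_congr_of_hom`) — the content of `Thm56Sub.LDeltaMapComp` at abc-iut-L2-t9's instance (P55-L06b).
[cite: MochizukiEtTh2009, Prop 5.5 proof p.328 (PDF p.102)] -/
theorem map_comp {E E' E'' : BTemp G} (hE : IsConnectedObj E) (hE' : IsConnectedObj E')
    (hE'' : IsConnectedObj E'') (f : E ⟶ E') (g : E' ⟶ E'') :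
    map q ι hE hE'' (f ≫ g) = (map q ι hE' hE'' g).comp (map q ι hE hE' f) := by
  refine MonoidHom.ext fun x => ?_
  induction x using QuotientGroup.induction_on with
  | H t =>
    change map q ι hE hE'' (f ≫ g) (mk q ι E t) = map q ι hE' hE'' g (map q ι hE hE' f (mk q ι E t))
    rw [map_mk, map_mk, map_mk, mk_eq_mk_iff]
    intro z
    rw [coe_famPush, coe_famPush, coe_famPush]
    -- both `pre (f ≫ g) z` and `pre f (pre g z)` map to `z` under `f ≫ g`
    have h1 : ((f ≫ g).hom.hom (pre hE hE'' (f ≫ g) z) : E''.obj.V) = z := apply_pre hE hE'' (f ≫ g) z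
    have h2 : ((f ≫ g).hom.hom (pre hE hE' f (pre hE' hE'' g z)) : E''.obj.V) = z := by
      rw [ObjectProperty.FullSubcategory.comp_hom, Action.comp_hom, types_comp_apply, apply_pre, apply_pre]
    have key := fam_apply_congr_of_hom q ι hE (f ≫ g) t (x := pre hE hE' f (pre hE' hE'' g z))
      (x' := pre hE hE'' (f ≫ g) z) (by rw [h1, h2])
    rwa [h2] at key

/-- **The transport along an identity is the identity**: `map (𝟙 E) = id` (the chosen preimage of `y` under `𝟙`
is `y` itself up to the family relation) — the content of `Thm56Sub.LDeltaMapId` at abc-iut-L2-t9's instance.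
[cite: MochizukiEtTh2009, Prop 5.5 proof p.328 (PDF p.102)] -/
theorem map_id {E : BTemp G} (hE : IsConnectedObj E) : map q ι hE hE (𝟙 E) = MonoidHom.id (LDelta q ι E) := by
  refine MonoidHom.ext fun x => ?_
  induction x using QuotientGroup.induction_on with
  | H t =>
    change map q ι hE hE (𝟙 E) (mk q ι E t) = mk q ι E t
    rw [map_mk, mk_eq_mk_iff]
    intro z
    rw [coe_famPush]
    have h1 : ((𝟙 E : E ⟶ E).hom.hom (pre hE hE (𝟙 E) z) : E.obj.V) = z := apply_pre hE hE (𝟙 E) z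
    have h2 : ((𝟙 E : E ⟶ E).hom.hom z : E.obj.V) = z := by
      rw [ObjectProperty.FullSubcategory.id_hom, Action.id_hom, types_id_apply]
    have key := fam_apply_congr_of_hom q ι hE (𝟙 E) t (x := z) (x' := pre hE hE (𝟙 E) z)
      (by rw [h1, h2])
    rwa [h2] at key

/-- **The laws `LDeltaMapComp` / `LDeltaMapId` at the instance `thetaSubquotientStub q ι`** over
`D = B^temp(Π)⁰` (abc-iut-L2-t9): the `lDeltaMap` of the instance is `map` (`thetaSubquotientStub_lDeltaMap`), so it
is functorial.  [cite: MochizukiEtTh2009, §5 p.327 (PDF p.101)] -/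
theorem thetaSubquotientStub_lDeltaMap_comp {E E' E'' : ConnectedPart (BTemp G)} (f : E ⟶ E') (g : E' ⟶ E'') :
    (thetaSubquotientStub q ι).lDeltaMap (f ≫ g) =
      ((thetaSubquotientStub q ι).lDeltaMap g).comp ((thetaSubquotientStub q ι).lDeltaMap f) := by
  rw [thetaSubquotientStub_lDeltaMap, thetaSubquotientStub_lDeltaMap, thetaSubquotientStub_lDeltaMap]
  exact map_comp q ι E.property E'.property E''.property f.hom g.hom

/-- `lDeltaMap (𝟙 E) = id` at the instance `thetaSubquotientStub q ι`. [cite: MochizukiEtTh2009, §5 p.327 (PDF p.101)] -/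
theorem thetaSubquotientStub_lDeltaMap_id (E : ConnectedPart (BTemp G)) :
    (thetaSubquotientStub q ι).lDeltaMap (𝟙 E) = MonoidHom.id _ := by
  rw [thetaSubquotientStub_lDeltaMap]
  exact map_id q ι E.property

end ThetaSubquotient

end Literature.AnabelianGeometry.EtaleTheta
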